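import Summits.Ventures.DiscreteObjects.Hadamard.Order225Excluded668

/-!
# Hadamard 668 census, family F12 — NO signed automorphism of an H(668) has pair-order `27·q` for `q ∈ {13, 23, 37}`
# (kernel, exclusion: orders 351, 621, 999)

Framing: lottery ticket; floor = certified bounds/negative ranges.

Cell pub-namedobj (venture DiscreteObjects), target (H), hadamard gen 18.  Orbit counting for a cyclic group `⟨π⟩` of
order `27q` on the rows, with `F_k = #Fix π^k`: the order-`q` census for `g^27` (`F₂₇ = 44 / ∈ {1,24} / = 2`), the
order-`9` structure for `g^q` (`F_{3q} ≤ 74`, `F_{3q} ≡ 2 (mod 6)`; cube: `F_{9q} ≤ 164`, `F_{9q} ≡ 2 (mod 18)`), the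
chains `3 ∣ F₃ − F₁`, `9 ∣ F₉ − F₃`, `27 ∣ F₂₇ − F₉`, `q ∣ F_q − F₁` and the inclusion–exclusion identities
`F_{3q} + F₁ = F₃ + F_q + 3q·x`, `F_{9q} + F₃ = F₉ + F_{3q} + 9q·y`, `668 + F₉ = F₂₇ + F_{9q} + 27q·z` (exact-period
sets, `dvd_card_period2`; Bezout, `card_fixed_incl_excl`) have no solution for `q ∈ {13, 23, 37}` (`omega`;
exact enumeration agrees: pub-namedobj-hadamard-g18/code/cyclic_orbit_types_g18.py, 0 orbit types; the orders
`27·7 = 189`, `27·11 = 297`, `27·5 = 135` and `9q` for `q ∈ {7, 11, 13, 23, 37}` DO have admissible orbit types).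
**`no_hadamard668_signedAut_order_27q`**, **`hadamard668_signedAut_not_dvd_orderOf_27q`**.  (Orders `27·41`,
`27·83`, `27·167` are already excluded through `369`, `249`, `501`.)  EXCLUSION of element orders only; H(668)
untouched.  Ours; no `sorry`, no definitions.
-/

namespace Summit.Ventures.DiscreteObjects.Hadamard

open Finset BigOperators Matrix

open Literature.Combinatorics.Designs.GoethalsSeidel (IsHadamardMatrix)

variable {ι : Type*} [Fintype ι] [DecidableEq ι]

/-! ### divisor tables for `27`, `3q`, `9q`, `27q` -/

/-- proper divisors of `27` divide `9` -/
lemma dvd_27_cases (d : ℕ) (hd : d ∣ 27) (hlt : d < 27) : d ∣ 9 ∨ d ∣ 9 := by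
  rcases Nat.eq_zero_or_pos d with rfl | hpos
  · simp at hd
  · interval_cases d <;> omega

/-- proper divisors of `3^k · q` (`q` prime, `q ≠ 3`): description via `Nat.dvd_mul` -/
lemma dvd_pow3_mul_prime {q d k : ℕ} (hq : q.Prime) (h : d ∣ 3 ^ k * q) :
    (∃ i, i ≤ k ∧ d = 3 ^ i) ∨ (∃ i, i ≤ k ∧ d = 3 ^ i * q) := by
  obtain ⟨d₁, d₂, h₁, h₂, rfl⟩ := Nat.dvd_mul.1 h
  obtain ⟨i, hi, rfl⟩ := (Nat.dvd_prime_pow (by norm_num : (3 : ℕ).Prime)).1 h₁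
  rcases (Nat.dvd_prime hq).1 h₂ with rfl | rfl
  · exact Or.inl ⟨i, hi, by simp⟩
  · exact Or.inr ⟨i, hi, rfl⟩

/-- proper divisors of `3q` divide `3` or `q` -/
lemma dvd_3q_cases {q : ℕ} (hq : q.Prime) (d : ℕ) (hd : d ∣ 3 * q) (hlt : d < 3 * q) :
    d ∣ 3 ∨ d ∣ q := by
  have hd' : d ∣ 3 ^ 1 * q := by simpa using hd
  rcases dvd_pow3_mul_prime hq hd' with ⟨i, hi, rfl⟩ | ⟨i, hi, rfl⟩
  · left; interval_cases i <;> norm_num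
  · interval_cases i
    · right; simp
    · exfalso; simp at hlt

/-- proper divisors of `9q` divide `9` or `3q` -/
lemma dvd_9q_cases {q : ℕ} (hq : q.Prime) (d : ℕ) (hd : d ∣ 9 * q) (hlt : d < 9 * q) :
    d ∣ 9 ∨ d ∣ 3 * q := by
  have hd' : d ∣ 3 ^ 2 * q := by simpa using hd
  rcases dvd_pow3_mul_prime hq hd' with ⟨i, hi, rfl⟩ | ⟨i, hi, rfl⟩
  · left; interval_cases i <;> norm_num
  · interval_cases i
    · right; simp
    · right; simp
    · exfalso; norm_num at hlt

/-- proper divisors of `27q` divide `27` or `9q` -/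
lemma dvd_27q_cases {q : ℕ} (hq : q.Prime) (d : ℕ) (hd : d ∣ 27 * q) (hlt : d < 27 * q) :
    d ∣ 27 ∨ d ∣ 9 * q := by
  have hd' : d ∣ 3 ^ 3 * q := by simpa using hd
  rcases dvd_pow3_mul_prime hq hd' with ⟨i, hi, rfl⟩ | ⟨i, hi, rfl⟩
  · left; interval_cases i <;> norm_num
  · interval_cases i
    · right; simp
    · right; exact Nat.mul_dvd_mul_right (by norm_num) q
    · right; norm_num
    · exfalso; norm_num at hlt

section main
variable {H : Matrix ι ι ℤ}

/-- **No signed automorphism of pair-order `27·q`, `q ∈ {13, 23, 37}`.** -/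
theorem no_hadamard668_signedAut_order_27q (hH : IsHadamardMatrix H) (hι : Fintype.card ι = 668)
    (π κ : Equiv.Perm ι) (d e : ι → ℤ) (haut : IsSignedAut H π κ d e) {q : ℕ} (hq : q = 13 ∨ q = 23 ∨ q = 37)
    (hπ : π ^ (27 * q) = 1) (hκ : κ ^ (27 * q) = 1)
    (h9q : π ^ (9 * q) ≠ 1 ∨ κ ^ (9 * q) ≠ 1) (h27 : π ^ 27 ≠ 1 ∨ κ ^ 27 ≠ 1) : False := by
  have hcard : (Fintype.card ι : ℤ) ≠ 0 := by rw [hι]; norm_num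
  have hqp : q.Prime := by rcases hq with rfl | rfl | rfl <;> norm_num
  have hq3 : q ≠ 3 := by rcases hq with rfl | rfl | rfl <;> norm_num
  have hq13 : 13 ≤ q := by rcases hq with rfl | rfl | rfl <;> norm_num
  have hqodd : Odd q := hqp.odd_of_ne_two (by omega)
  -- the order-q part g^27: census
  have haut27 := isSignedAut_pow haut 27
  have hπ27 : (π ^ 27) ^ q = 1 := by rw [← pow_mul]; exact hπ
  have hκ27 : (κ ^ 27) ^ q = 1 := by rw [← pow_mul]; exact hκ
  have hne27 : π ^ 27 ≠ 1 := fst_pow_ne_one hH hcard haut hqodd hκ27 h27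
  obtain ⟨-, hwin⟩ := hadamard668_signedAut_fixedRows hH hι q hqp hq13 (π ^ 27) (κ ^ 27) _ _ haut27 hπ27 hκ27
    (Or.inl hne27)
  -- the order-9 part g^(3q) (its cube g^(9q) has order 3)
  have haut3q := isSignedAut_pow haut (3 * q)
  have hπ3q : (π ^ (3 * q)) ^ 9 = 1 := by rw [← pow_mul, show 3 * q * 9 = 27 * q by ring]; exact hπ
  have hκ3q : (κ ^ (3 * q)) ^ 9 = 1 := by rw [← pow_mul, show 3 * q * 9 = 27 * q by ring]; exact hκ
  have hne3 : (π ^ (3 * q)) ^ 3 ≠ 1 ∨ (κ ^ (3 * q)) ^ 3 ≠ 1 := by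
    rw [← pow_mul, ← pow_mul, show 3 * q * 3 = 9 * q by ring]; exact h9q
  obtain ⟨heq9, hw6, hw74⟩ := hadamard668_order9_fixed_eq hH hι (π ^ (3 * q)) (κ ^ (3 * q)) _ _ haut3q hπ3q hκ3q hne3
  obtain ⟨⟨hR18, -, hR164, -, -, -⟩, -⟩ :=
    hadamard668_order9_structure hH hι (π ^ (3 * q)) (κ ^ (3 * q)) _ _ haut3q hπ3q hκ3q hne3
  rw [← heq9] at hw6 hw74
  rw [← pow_mul, show 3 * q * 3 = 9 * q by ring] at hR18 hR164
  -- orbit counting on rows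
  have hc3 := dvd_card_fixed_pow_sdiff π (by norm_num : (3 : ℕ).Prime)
  have hcq := dvd_card_fixed_pow_sdiff π hqp
  have hc9 := dvd_card_fixed_sq_sdiff π (by norm_num : (3 : ℕ).Prime)
  rw [show (3 : ℕ) * 3 = 9 from rfl] at hc9
  have hc27 := dvd_card_period2 π (n := 27) (a := 9) (b := 9) (by norm_num) dvd_27_cases
  have hc3q := dvd_card_period2 π (n := 3 * q) (a := 3) (b := q) (by omega) (dvd_3q_cases hqp)
  have hc9q := dvd_card_period2 π (n := 9 * q) (a := 9) (b := 3 * q) (by omega) (dvd_9q_cases hqp)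
  have hc27q := dvd_card_period2 π (n := 27 * q) (a := 27) (b := 9 * q) (by omega) (dvd_27q_cases hqp)
  have hs3 := card_split_by_fixed π (fun i => (π ^ 3) i = i) (fun i h => perm_pow_apply_of_fixed π h 3)
  have hsq := card_split_by_fixed π (fun i => (π ^ q) i = i) (fun i h => perm_pow_apply_of_fixed π h q)
  have hs9 := card_split_by_fixed (π ^ 3) (fun i => (π ^ 9) i = i)
    (fun i h => by rw [show (9 : ℕ) = 3 * 3 from rfl, pow_mul]; exact perm_pow_apply_of_fixed _ h 3)
  have hs27 := card_fixed_incl_excl π (n := 27) (a := 9) (b := 9) (by norm_num) (by norm_num)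
  have hs3q := card_fixed_incl_excl π (n := 3 * q) (a := 3) (b := q) (dvd_mul_right 3 q) (dvd_mul_left q 3)
  have hs9q := card_fixed_incl_excl π (n := 9 * q) (a := 9) (b := 3 * q) (dvd_mul_right 9 q)
    (Nat.mul_dvd_mul_right (by norm_num) q)
  have hs27q := card_fixed_incl_excl π (n := 27 * q) (a := 27) (b := 9 * q) (dvd_mul_right 27 q)
    (Nat.mul_dvd_mul_right (by norm_num) q)
  have hg99 : Nat.gcd 9 9 = 9 := by norm_num
  have hg3q : Nat.gcd 3 q = 1 := Nat.Coprime.gcd_eq_one ((Nat.coprime_primes (by norm_num) hqp).2 hq3.symm)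
  have hg93q : Nat.gcd 9 (3 * q) = 3 := by
    rw [show (9 : ℕ) = 3 * 3 from rfl, Nat.gcd_mul_left, hg3q]
  have hg279q : Nat.gcd 27 (9 * q) = 9 := by
    rw [show (27 : ℕ) = 9 * 3 from rfl, Nat.gcd_mul_left, hg3q]
  rw [hg99] at hs27
  rw [hg3q, pow_one] at hs3q
  rw [hg93q] at hs9q
  rw [hg279q] at hs27q
  have htop : (univ.filter fun y => (π ^ (27 * q)) y = y).card = 668 := by
    rw [← hι, ← Finset.card_univ]; congr 1; ext y; simp [hπ]
  -- scalarise
  obtain ⟨F1, hF1⟩ : ∃ m : ℕ, m = (univ.filter fun i => π i = i).card := ⟨_, rfl⟩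
  obtain ⟨F3, hF3⟩ : ∃ m : ℕ, m = (univ.filter fun i => (π ^ 3) i = i).card := ⟨_, rfl⟩
  obtain ⟨F9, hF9⟩ : ∃ m : ℕ, m = (univ.filter fun i => (π ^ 9) i = i).card := ⟨_, rfl⟩
  obtain ⟨F27, hF27⟩ : ∃ m : ℕ, m = (univ.filter fun i => (π ^ 27) i = i).card := ⟨_, rfl⟩
  obtain ⟨Fq, hFq⟩ : ∃ m : ℕ, m = (univ.filter fun i => (π ^ q) i = i).card := ⟨_, rfl⟩
  obtain ⟨F3q, hF3q⟩ : ∃ m : ℕ, m = (univ.filter fun i => (π ^ (3 * q)) i = i).card := ⟨_, rfl⟩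
  obtain ⟨F9q, hF9q⟩ : ∃ m : ℕ, m = (univ.filter fun i => (π ^ (9 * q)) i = i).card := ⟨_, rfl⟩
  obtain ⟨a3, ha3⟩ := hc3
  obtain ⟨aq, haq⟩ := hcq
  obtain ⟨a9, ha9⟩ := hc9
  obtain ⟨a27, ha27⟩ := hc27
  obtain ⟨x3q, hx3q⟩ := hc3q
  obtain ⟨x9q, hx9q⟩ := hc9q
  obtain ⟨x27q, hx27q⟩ := hc27q
  rw [ha3, ← hF1, ← hF3] at hs3
  rw [haq, ← hF1, ← hFq] at hsq
  rw [ha9, ← hF3, ← hF9] at hs9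
  rw [ha27, ← hF27, ← hF9] at hs27
  rw [hx3q, ← hF3q, ← hF1, ← hF3, ← hFq] at hs3q
  rw [hx9q, ← hF9q, ← hF3, ← hF9, ← hF3q] at hs9q
  rw [hx27q, htop, ← hF9, ← hF27, ← hF9q] at hs27q
  rw [← hF27] at hwin
  rw [← hF3q] at hw6 hw74
  rw [← hF9q] at hR18 hR164
  clear * - hq hs3 hsq hs9 hs27 hs3q hs9q hs27q hwin hw6 hw74 hR18 hR164
  rcases hq with rfl | rfl | rfl
  · rcases hwin with ⟨-, hw⟩ | ⟨h, -⟩ | ⟨h, -⟩ | ⟨h, -⟩ | ⟨h, -⟩ | ⟨h, -⟩ <;> omega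
  · rcases hwin with ⟨h, -⟩ | ⟨-, hw⟩ | ⟨h, -⟩ | ⟨h, -⟩ | ⟨h, -⟩ | ⟨h, -⟩ <;> omega
  · rcases hwin with ⟨h, -⟩ | ⟨h, -⟩ | ⟨-, hw⟩ | ⟨h, -⟩ | ⟨h, -⟩ | ⟨h, -⟩ <;> omega

/-- **`27·q ∤ orderOf (π, κ)`** for every signed automorphism of an H(668), `q ∈ {13, 23, 37}`. -/
theorem hadamard668_signedAut_not_dvd_orderOf_27q (hH : IsHadamardMatrix H) (hι : Fintype.card ι = 668)
    (π κ : Equiv.Perm ι) (d e : ι → ℤ) (haut : IsSignedAut H π κ d e) {q : ℕ} (hq : q = 13 ∨ q = 23 ∨ q = 37)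
    (hdvd : 27 * q ∣ orderOf ((π, κ) : Equiv.Perm ι × Equiv.Perm ι)) : False := by
  set x : Equiv.Perm ι × Equiv.Perm ι := (π, κ) with hx
  have hx0 : orderOf x ≠ 0 := (orderOf_pos x).ne'
  set k := orderOf x / (27 * q) with hk
  have hord : orderOf (x ^ k) = 27 * q := orderOf_pow_orderOf_div hx0 hdvd
  have hxk : x ^ k = ((π ^ k, κ ^ k) : Equiv.Perm ι × Equiv.Perm ι) := by rw [hx, Prod.pow_mk]
  rw [hxk] at hord
  have hq13 : 13 ≤ q := by rcases hq with rfl | rfl | rfl <;> norm_num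
  obtain ⟨h1, h2, h3⟩ := pow_data_of_orderOf hord (a := 9 * q) (by omega) (by omega)
  obtain ⟨-, -, h4⟩ := pow_data_of_orderOf hord (a := 27) (by norm_num) (by omega)
  exact no_hadamard668_signedAut_order_27q hH hι (π ^ k) (κ ^ k) _ _ (isSignedAut_pow haut k) hq h1 h2 h3 h4

end main

end Summit.Ventures.DiscreteObjects.Hadamard
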